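import Summits.QuantumFields.YangMills.Theorems.BalabanUVNodesN14ConvexFibreMatchingBox

/-!
# BalabanUVNodes ∕ node N14 = NE1′ — THE CONSISTENCY DEFECT: when run K's class law is only a BOUNDED TILT of the exact marginal of run K+1
# (density ratio `e^{±δ_K}` — the renormalisation-group consistency defect), the residual binder still holds with `η K + B₀(e^{2δ_K} − 1)`

Cell `pub-ymgap`, HUMAN RULING D-0062 (Track A at full width), seat `pub-ymgap-dag-n14-c` (R134 ACCELERATION, strategy s1), generation 4;
route `Summits/QuantumFields/YangMills/Theses/BalabanUVNodes.lean` (cluster K3′ `SpineGivenEndpointR12`, `--supports … --as helper`); venue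
ruling R424 (`YangMills/Theorems`, namespace `YMDAG.N14.ConvexFibreConsistency`).  Tenth file of the convex-fibre engine.  ADDITIVE — imports H
(`…ConvexFibreMatchingBox`, hence G's generic tilt lemmas); THEOREMS ONLY (0 `def`), modifies nothing.

WHY.  Files G∕H produce `TiltedMeanMatching` on a CONSISTENT tower — run K's class law IS the marginal of run K+1's.  For Bałaban's runs this
holds only up to the renormalisation-group corrections: the class law of run K and the marginal of run K+1 differ by a density ratio, which the
small-field analysis delivers as `e^{±δ_K}` with `δ_K` summable (NE5∕NE7's output-rate letter — NOT produced here).  This file isolates that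
division of labour: a bounded tilt `g` (`|g| ≤ δ`) of a law moves every tilted mean of a `B₀`-bounded observable by at most `B₀·(e^{2δ} − 1)`
(G's two-tilt lemma after Mathlib's `tilted_tilted`), so the residual binder on a `δ`-CONSISTENT tower costs `η K + B₀·(e^{2δ_K} − 1)` — summable iff
`Σ (L K)² < ∞` AND `Σ δ_K < ∞`.

WHAT THIS IS.
* §1 [folklore] `abs_tiltedMean_tilted_sub_le` — `μ` a probability law, `g` measurable with `|g| ≤ δ`, `F` measurable with `|F| ≤ B₀`:
  `|tiltedMean F (μ.tilted g) s − tiltedMean F μ s| ≤ B₀·(e^{2δ} − 1)` for every `s`.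
* §2 **`abs_tiltedMean_compProd_sub_le_of_defect`** — run B `= ν ⊗ₘ κ` (fibres with RR-2's schema `C` uniformly in the background), run A `= ν.tilted g`
  (`|g| ≤ δ`: the consistency defect) with observable the fibre average: `|tiltedMean G (ν ⊗ₘ κ) s − tiltedMean Ḡ (ν.tilted g) s| ≤
  |s|·C·e^{4l₀B₀}·L² + B₀·(e^{C·L²·s²} − 1) + B₀·(e^{2δ} − 1)`.
* §3 **`tiltedMeanMatching_of_defectSchemaTower`** — the K-indexed binder: exact marginals `ν K τ` (finite class pieces), run A laws
  `ν₁ K τ = (ν K τ).tilted (g K τ)` with `|g K τ| ≤ δ K`, fibres with the schema `C` ⇒ `TiltedMeanMatching l₀ T Bad (fibre averages) ν₁ G (ν ⊗ₘ κ)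
  (fun K => l₀·C·e^{4l₀B₀}·(L K)² + B₀·(e^{C(L K)²l₀²} − 1) + B₀·(e^{2 δ K} − 1))`.

WHAT THIS IS NOT.  Everything here is PROVED (0 `sorry`, 0 named facts).  The defect letter `δ_K` (and its summability), the schema ∕ convexity of
the history-conditioned fibre actions uniformly in the history, and the fibre-gradient decay are the hypotheses of any application — NE5∕NE7's and
NODE O's objects; nothing of Bałaban's instantiated; N14 NOT discharged; count-neutral.  One finite four-torus programme at fixed ε; NOT ℝ⁴, NOT OS,
NOT a mass gap, NOT Clay.
-/

noncomputable section

namespace YMDAG.N14.ConvexFibreConsistency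

open MeasureTheory ProbabilityTheory Set Filter Topology
open scoped RealInnerProductSpace ENNReal NNReal
open Literature.Analysis.FunctionSpaces (HasEntropyExpC1c)
open Summit.QuantumFields.BalabanUV.T4Continuum.NE1p.DressedMGFForm (tiltedMean TiltedMeanMatching)
open YMDAG.N14.ConvexFibreStep (measurable_fibreAvg abs_fibreAvg_le)
open YMDAG.N14.ConvexFibreMatching (abs_integral_tilted_sub_tilted_le tiltedMean_smul_measure)
open YMDAG.N14.ConvexFibreMatchingBox (abs_tiltedMean_compProd_sub_le_of_schema)

variable {n : ℕ}

/-! ## §1 A bounded tilt of the law moves tilted means by `B₀(e^{2δ} − 1)` -/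
section Defect

variable {Ω : Type*} [MeasurableSpace Ω] {μ : Measure Ω} [IsProbabilityMeasure μ] {g F : Ω → ℝ} {δ B₀ : ℝ}

/-- **A BOUNDED TILT OF THE LAW MOVES EVERY TILTED MEAN BY AT MOST `B₀(e^{2δ} − 1)`** [folklore ∘ G's `abs_integral_tilted_sub_tilted_le`, Mathlib
`tilted_tilted`]: `μ` a probability law, `g` measurable with `|g| ≤ δ`, `F` measurable with `|F| ≤ B₀` ⇒ for every tilt `s`,
`|tiltedMean F (μ.tilted g) s − tiltedMean F μ s| ≤ B₀·(e^{2δ} − 1)` (the two tilts `g + sF` and `sF` of `μ` differ by `|g| ≤ δ`). -/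
theorem abs_tiltedMean_tilted_sub_le (hgm : Measurable g) (hgb : ∀ x, |g x| ≤ δ) (hFm : Measurable F) (hFb : ∀ x, |F x| ≤ B₀) (s : ℝ) :
    |tiltedMean F (μ.tilted g) s - tiltedMean F μ s| ≤ B₀ * (Real.exp (2 * δ) - 1) := by
  have hgi : Integrable (fun x => Real.exp (g x)) μ := by
    have := Literature.Probability.Moments.integrable_exp_mul_of_abs_le_const μ hgm hgb 1; simpa using this
  rw [tiltedMean, tiltedMean, tilted_tilted hgi]
  have hsFb : ∀ x, |s * F x| ≤ |s| * B₀ := fun x => by rw [abs_mul]; exact mul_le_mul_of_nonneg_left (hFb x) (abs_nonneg s)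
  have h1b : ∀ x, |(g + fun x => s * F x) x| ≤ δ + |s| * B₀ := fun x => by
    simp only [Pi.add_apply]
    exact (abs_add_le _ _).trans (add_le_add (hgb x) (hsFb x))
  exact abs_integral_tilted_sub_tilted_le (ν := μ) (hgm.add (hFm.const_mul s)) (hFm.const_mul s) h1b hsFb hFm hFb fun x => by
    simp only [Pi.add_apply, add_sub_cancel_right]; exact hgb x

end Defect

/-! ## §2 The matching across one schema fibre against a `δ`-consistent run A -/
section Step

variable {B : Type*} [MeasurableSpace B] {ν : Measure B} [IsProbabilityMeasure ν] {κ : Kernel B (EuclideanSpace ℝ (Fin n))}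
  [IsMarkovKernel κ] {G : B × EuclideanSpace ℝ (Fin n) → ℝ} {g : B → ℝ} {C l₀ s B₀ L δ : ℝ}

/-- **THE TWO-RUN MATCHING WITH A CONSISTENCY DEFECT** [folklore ∘ H §1 + §1].  Run B: `ν ⊗ₘ κ` with observable `G` (every fibre law with
`HasEntropyExpC1c (κ b) C`, `C > 0`; `G` measurable, `|G| ≤ B₀`, fibrewise `C¹` with gradient `≤ L`, `L > 0`).  Run A: the DEFECTIVE marginal
`ν.tilted g` (`g` measurable, `|g| ≤ δ`) with observable the fibre average `Ḡ`.  Then for `|s| ≤ l₀`: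
`|tiltedMean G (ν ⊗ₘ κ) s − tiltedMean Ḡ (ν.tilted g) s| ≤ |s|·C·e^{4l₀B₀}·L² + B₀·(e^{C·L²·s²} − 1) + B₀·(e^{2δ} − 1)`. -/
theorem abs_tiltedMean_compProd_sub_le_of_defect (hκC : ∀ b, HasEntropyExpC1c (κ b) C) (hC : 0 < C) (hGm : Measurable G)
    (hG : ∀ b, ContDiff ℝ 1 fun x => G (b, x)) (hGb : ∀ p, |G p| ≤ B₀) (hGD : ∀ b x, ‖fderiv ℝ (fun z => G (b, z)) x‖ ≤ L) (hL : 0 < L)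
    (hs : |s| ≤ l₀) (hgm : Measurable g) (hgb : ∀ b, |g b| ≤ δ) :
    |tiltedMean G (ν ⊗ₘ κ) s - tiltedMean (fun b => ∫ x, G (b, x) ∂(κ b)) (ν.tilted g) s| ≤
      |s| * (C * Real.exp (4 * l₀ * B₀) * L ^ 2) + B₀ * (Real.exp (C * L ^ 2 * s ^ 2) - 1) + B₀ * (Real.exp (2 * δ) - 1) := by
  have h1 := abs_tiltedMean_compProd_sub_le_of_schema (ν := ν) (κ := κ) hκC hC hGm hG hGb hGD hL hs
  have h2 := abs_tiltedMean_tilted_sub_le (μ := ν) hgm hgb (measurable_fibreAvg (κ := κ) hGm) (abs_fibreAvg_le (κ := κ) hGb) s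
  rw [abs_sub_comm] at h2
  calc |tiltedMean G (ν ⊗ₘ κ) s - tiltedMean (fun b => ∫ x, G (b, x) ∂(κ b)) (ν.tilted g) s|
      ≤ |tiltedMean G (ν ⊗ₘ κ) s - tiltedMean (fun b => ∫ x, G (b, x) ∂(κ b)) ν s| +
          |tiltedMean (fun b => ∫ x, G (b, x) ∂(κ b)) ν s - tiltedMean (fun b => ∫ x, G (b, x) ∂(κ b)) (ν.tilted g) s| := abs_sub_le _ _ _
    _ ≤ _ := add_le_add h1 h2

end Step

/-! ## §3 The binder on a `δ`-consistent schema tower -/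
section Tower

variable {ι : Type*} [DecidableEq ι] {Ω : ℕ → Type*} [∀ K, MeasurableSpace (Ω K)] {d : ℕ → ℕ}
  {T : ℕ → Finset ι} {Bad : ℕ → ℝ → Finset ι} {l₀ B₀ C : ℝ} {L δ : ℕ → ℝ}
  {ν ν₁ : ∀ K, ι → Measure (Ω K)} {κ : ∀ K, Kernel (Ω K) (EuclideanSpace ℝ (Fin (d K)))} {G : ∀ K, Ω K × EuclideanSpace ℝ (Fin (d K)) → ℝ}
  {g : ∀ K, ι → Ω K → ℝ}

/-- **`TiltedMeanMatching` ON A `δ`-CONSISTENT SCHEMA TOWER** [folklore ∘ §2].  Depth `K`, class `τ`: `ν K τ` the EXACT marginal of run B's class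
piece (a finite measure), run B `= ν K τ ⊗ₘ κ K` with observable `G K` (fibres with `HasEntropyExpC1c (κ K b) C`, `G K` bounded by `B₀`, fibrewise
`C¹` with gradient size `L K > 0`); run A's class law `ν₁ K τ = (ν K τ).tilted (g K τ)` — the exact marginal up to the CONSISTENCY DEFECT `|g K τ| ≤ δ K`
— with observable the fibre average.  Then `TiltedMeanMatching l₀ T Bad (fibre averages) ν₁ G (ν ⊗ₘ κ) η` with
`η K = l₀·C·e^{4l₀B₀}·(L K)² + B₀·(e^{C(L K)²l₀²} − 1) + B₀·(e^{2δ K} − 1)` — summable iff `Σ (L K)² < ∞` AND `Σ δ K < ∞`: the engine's part and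
NE5∕NE7's part of the residual, separated. -/
theorem tiltedMeanMatching_of_defectSchemaTower (hC : 0 < C) (hB₀ : 0 ≤ B₀) (hl₀ : 0 ≤ l₀)
    (hν : ∀ K, ∀ τ ∈ T K, IsFiniteMeasure (ν K τ)) (hκM : ∀ K, IsMarkovKernel (κ K)) (hκC : ∀ K b, HasEntropyExpC1c (κ K b) C)
    (hGm : ∀ K, Measurable (G K)) (hG : ∀ K b, ContDiff ℝ 1 fun x => G K (b, x)) (hGb : ∀ K p, |G K p| ≤ B₀)
    (hGD : ∀ K b x, ‖fderiv ℝ (fun z => G K (b, z)) x‖ ≤ L K) (hL : ∀ K, 0 < L K)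
    (hδ : ∀ K, 0 ≤ δ K) (hgm : ∀ K τ, Measurable (g K τ)) (hgb : ∀ K τ b, |g K τ b| ≤ δ K)
    (hν₁ : ∀ K τ, ν₁ K τ = (ν K τ).tilted (g K τ)) :
    TiltedMeanMatching l₀ T Bad (fun K b => ∫ x, G K (b, x) ∂(κ K b)) ν₁ G (fun K τ => ν K τ ⊗ₘ κ K)
      (fun K => l₀ * (C * Real.exp (4 * l₀ * B₀) * L K ^ 2) + B₀ * (Real.exp (C * L K ^ 2 * l₀ ^ 2) - 1) + B₀ * (Real.exp (2 * δ K) - 1)) := by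
  intro K t _ τ hτ s hs
  have hτT : τ ∈ T K := (Finset.mem_sdiff.mp hτ).1
  haveI := hν K τ hτT
  haveI := hκM K
  have hδ0 : 0 ≤ δ K := hδ K
  have hη0 : 0 ≤ l₀ * (C * Real.exp (4 * l₀ * B₀) * L K ^ 2) + B₀ * (Real.exp (C * L K ^ 2 * l₀ ^ 2) - 1) + B₀ * (Real.exp (2 * δ K) - 1) := by
    have e1 : (1 : ℝ) ≤ Real.exp (C * L K ^ 2 * l₀ ^ 2) := Real.one_le_exp (by positivity)
    have e2 : (1 : ℝ) ≤ Real.exp (2 * δ K) := Real.one_le_exp (by positivity)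
    have h2 : 0 ≤ B₀ * (Real.exp (C * L K ^ 2 * l₀ ^ 2) - 1) := mul_nonneg hB₀ (by linarith)
    have h3 : 0 ≤ B₀ * (Real.exp (2 * δ K) - 1) := mul_nonneg hB₀ (by linarith)
    positivity
  rw [hν₁ K τ]
  by_cases h0 : ν K τ = 0
  · simp only [h0, Measure.compProd_zero_left, tiltedMean, tilted_zero_measure, integral_zero_measure, sub_zero, abs_zero]
    exact hη0
  set c : ℝ≥0∞ := ν K τ Set.univ with hc
  have hc0 : c ≠ 0 := by rwa [hc, Ne, Measure.measure_univ_eq_zero]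
  have hcT : c ≠ ∞ := measure_ne_top _ _
  have hci0 : c⁻¹ ≠ 0 := ENNReal.inv_ne_zero.2 hcT
  have hciT : c⁻¹ ≠ ∞ := ENNReal.inv_ne_top.2 hc0
  haveI : IsProbabilityMeasure (c⁻¹ • ν K τ) :=
    ⟨by rw [Measure.smul_apply, smul_eq_mul, hc, ENNReal.inv_mul_cancel hc0 hcT]⟩
  -- normalise: tilts and the composite law do not see the scalar
  have e0 : (ν K τ).tilted (g K τ) = (c⁻¹ • ν K τ).tilted (g K τ) :=
    (Literature.Barriers.CriticalPhenomena.HierarchicalRG.tilted_smul_measure _ _ hci0 hciT).symm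
  have e2 : tiltedMean (G K) (ν K τ ⊗ₘ κ K) s = tiltedMean (G K) ((c⁻¹ • ν K τ) ⊗ₘ κ K) s := by
    rw [Measure.compProd_smul_left, tiltedMean_smul_measure _ _ hci0 hciT]
  rw [e0, e2]
  have hmain := abs_tiltedMean_compProd_sub_le_of_defect (ν := c⁻¹ • ν K τ) (κ := κ K) (hκC K) hC (hGm K) (hG K) (hGb K) (hGD K) (hL K) hs
    (hgm K τ) (hgb K τ)
  refine hmain.trans (add_le_add (add_le_add ?_ ?_) le_rfl)
  · exact mul_le_mul_of_nonneg_right hs (by positivity)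
  · refine mul_le_mul_of_nonneg_left ?_ hB₀
    have hss : s ^ 2 ≤ l₀ ^ 2 := by
      rw [← sq_abs s]; exact pow_le_pow_left₀ (abs_nonneg s) hs 2
    have : C * L K ^ 2 * s ^ 2 ≤ C * L K ^ 2 * l₀ ^ 2 := mul_le_mul_of_nonneg_left hss (by positivity)
    linarith [Real.exp_le_exp.2 this]

end Tower

end YMDAG.N14.ConvexFibreConsistency

end
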